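import Literature.NumberTheory.LFunctions.Zhang2022.DetectorClassDET

/-!
# Zhang (2022), programme F-S3 (cell landau-siegel, family B-det): the class-DET predicate on EVERY finite
# shift count (widening (i′)) and «configuration-valid endgames are ≥ 0 on PSD Gram arrays» (E-det-7)

Y. Zhang, *Discrete mean estimates and the Landau–Siegel zero*, arXiv:2211.02515v1 [Zhang2022LandauSiegel] —
an unrefereed manuscript under adjudication. **WHAT THIS IS NOT: not a claim about Theorems 1–2 of
arXiv:2211.02515, about Landau–Siegel zeros, or about Parity; nothing here asserts any claim of the manuscript.**
«The programme SEARCHES and TYPES; no claim about Landau–Siegel zeros, Theorems 1–2 of arXiv:2211.02515 or a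
repaired Margin232 until a kernel theorem says so.»

A leaf companion of `DetectorClassDET` (the class data `Det.DETDesign k` — shift data `(b_j,e_j)_{j<k}`, weight
polynomials `P₀, P₁` of total degree `≤ 3` in the `k` shifted `M`-values, phase, sampling, family, amplifier — and
the predicate `Det.ModelBarrier fence err`, which quantifies over `k ≤ 3`). Two small additions asked of the
typer by the family's writer and referee (cell documents, not literature: REF-B1 rulings R-d2p-2 «class
membership» 2026-08-26T22:09:15Z and E-det-7 22:30:42Z; KILL-CERT(B-det) §2 (i′)):

* **(i′) widening.** The DATA `Det.DETDesign k` is already generic in the shift count `k` (the bound `≤ 3` is on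
  the total DEGREE of `P₀, P₁`, not on `k`); only the predicate `Det.ModelBarrier` restricts to `k ≤ 3`.
  `Det.ModelBarrierAll fence err` is the same predicate on EVERY finite `k` (the widened clause (ii)/(i′):
  «`P₀, P₁` real/complex cubic forms in any finite number `K` of shifted `M`-values»), with
  `ModelBarrierAll.restrict : ModelBarrierAll fence err → ModelBarrier fence err`, `modelBarrierAll_iff`
  (`= ModelBarrier ∧` the `k > 3` members) and `ModelBarrierAll.zhang`. The parenthesis of R-d2p-2 «each monomial
  involves `≤ 3` shifts — automatic for degree `≤ 3`» is PROVED: `Det.card_support_le_totalDegree` and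
  `Det.DETDesign.monomial_shifts_le_three` (every monomial in the support of `P₀` or `P₁` has `≤ 3` variables).
  Both predicates are stated, never asserted.
* **E-det-7 (REF-B1's kernel lemma, landed verbatim up to docstrings).** By the spectral theorem a positive
  semidefinite Hermitian Gram array IS the Gram array `Det.configGram` of a finite configuration with non-negative
  weights (points = eigen-indices, weights = eigenvalues, test values = eigenvector coordinates):
  `Det.configGram_of_posSemidef`; hence EVERY configuration-valid endgame objective (`Det.ConfigValid Φ`: `Φ ≥ 0`
  on all non-negatively weighted finite configurations — `posEndgame`, `csEndgame`, …) is `≥ 0` on every PSD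
  array: `Det.ConfigValid.nonneg_of_posSemidef`. This is the linear-algebra sentence «CS/Gram-type endgames
  REDUCE to positive-semidefiniteness of the recipe array» used by the family word; no (A), no soundness chain.

## References
* [Zhang2022LandauSiegel] Y. Zhang, arXiv:2211.02515v1 (2022), §2 (2.13)–(2.19), (2.32)–(2.34); §7 Prop. 7.1;
  §8 Lemma 8.1.
* Cell documents (not literature): `B-det/KILL-draft.md` v2.1 §2 (i)–(iv)+(i′); REF-B1 R-d2p-2, E-det-7;
  `HOME/ls-B-ref-1/PsdConfigValid.lean` sha16 312b75ff236bd1dd (the scratch landed in Part 2).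
-/

open Matrix
open scoped ComplexOrder

namespace Literature.NumberTheory.LFunctions.Zhang2022.Det

open DetTemplate

/-! ## Part 1 · (i′): the class predicate on every finite shift count -/

/-- **det-E5 first half / clause (i′) ON a fence functional, EVERY finite shift count**: for every `c′ > 0`,
every `k : ℕ` and every design `d : DETDesign k` (weight `c₀·a(ψ)·(P₀ + P₁/M′)·ω` with `P₀, P₁` cubic forms in
the `k` shifted `M`-values `M(ρ+β_j,ψ)`, `b_j ∈ (0,5)`), under (A) the discrete mean of `d` against any
(7.2)-admissible coefficient pair evaluates to `fence d c′ · 𝔓 + O(err d c′) + o(𝔓)` (`Detector.MainEval`).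
The `k ≤ 3` predicate `Det.ModelBarrier` is its restriction (`ModelBarrierAll.restrict`). A predicate ON the
functional — stated, never asserted. [cite: Zhang2022LandauSiegel, §7 Prop. 7.1, §8 Lemma 8.1] -/
def ModelBarrierAll (fence : FenceModel) (err : FenceError) : Prop :=
  ∀ c' : ℝ, 0 < c' → ∀ (k : ℕ) (d : DETDesign k), (d.detector c').MainEval (fence k d c') (err k d c')

/-- The widened predicate restricts to the `k ≤ 3` predicate of `DetectorClassDET`.
[cite: Zhang2022LandauSiegel, §7 Prop. 7.1, §8 Lemma 8.1] -/
theorem ModelBarrierAll.restrict {fence : FenceModel} {err : FenceError} (h : ModelBarrierAll fence err) :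
    ModelBarrier fence err :=
  fun c' hc k _ d => h c' hc k d

/-- Member access: the widened predicate at one design of any shift count.
[cite: Zhang2022LandauSiegel, §7 Prop. 7.1, §8 Lemma 8.1] -/
theorem ModelBarrierAll.apply {fence : FenceModel} {err : FenceError} (h : ModelBarrierAll fence err)
    {c' : ℝ} (hc : 0 < c') {k : ℕ} (d : DETDesign k) :
    (d.detector c').MainEval (fence k d c') (err k d c') :=
  h c' hc k d

/-- The widened predicate is the `k ≤ 3` predicate together with its `k > 3` members.
[cite: Zhang2022LandauSiegel, §7 Prop. 7.1, §8 Lemma 8.1] -/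
theorem modelBarrierAll_iff (fence : FenceModel) (err : FenceError) :
    ModelBarrierAll fence err ↔
      ModelBarrier fence err ∧
        ∀ c' : ℝ, 0 < c' → ∀ (k : ℕ), 3 < k → ∀ d : DETDesign k,
          (d.detector c').MainEval (fence k d c') (err k d c') := by
  constructor
  · exact fun h => ⟨h.restrict, fun c' hc k _ d => h c' hc k d⟩
  · rintro ⟨h3, hgt⟩ c' hc k d
    rcases Nat.lt_or_ge 3 k with hk | hk
    · exact hgt c' hc k hk d
    · exact h3 c' hc k hk d

/-- The widened predicate contains the manuscript's detector (`k = 3`).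
[cite: Zhang2022LandauSiegel, §7 Prop. 7.1, §8 Lemma 8.1] -/
theorem ModelBarrierAll.zhang {fence : FenceModel} {err : FenceError} (h : ModelBarrierAll fence err)
    {c' : ℝ} (hc : 0 < c') :
    (DetTemplate.zhang c').MainEval (fence 3 zhangDesign c') (err 3 zhangDesign c') :=
  h.restrict.zhang hc

/-! ### «Each monomial involves `≤ 3` shifts — automatic for degree `≤ 3`» -/

/-- A monomial exponent vector has at most `(its degree)` variables in its support. [folklore] -/
private theorem card_support_le_sum {σ : Type*} (s : σ →₀ ℕ) : s.support.card ≤ s.sum fun _ e => e := by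
  rw [Finsupp.sum, Finset.card_eq_sum_ones]
  exact Finset.sum_le_sum fun i hi => Nat.one_le_iff_ne_zero.mpr (Finsupp.mem_support_iff.mp hi)

/-- **Every monomial of a polynomial of total degree `≤ n` involves `≤ n` variables.**
[cite: Zhang2022LandauSiegel, §2 (2.13)–(2.16)] -/
theorem card_support_le_totalDegree {σ R : Type*} [CommSemiring R] {p : MvPolynomial σ R} {s : σ →₀ ℕ}
    (h : s ∈ p.support) : s.support.card ≤ p.totalDegree :=
  (card_support_le_sum s).trans (MvPolynomial.le_totalDegree h)

/-- **R-d2p-2's parenthesis for the class data**: every monomial of `P₀` and of `P₁` of a DET design (any shift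
count `k`) involves at most `3` of the shifted `M`-values. [cite: Zhang2022LandauSiegel, §2 (2.13)–(2.16)] -/
theorem DETDesign.monomial_shifts_le_three {k : ℕ} (d : DETDesign k) :
    (∀ s ∈ d.P0.support, s.support.card ≤ 3) ∧ (∀ s ∈ d.P1.support, s.support.card ≤ 3) :=
  ⟨fun _ hs => (card_support_le_totalDegree hs).trans d.deg0_le,
    fun _ hs => (card_support_le_totalDegree hs).trans d.deg1_le⟩

/-! ## Part 2 · E-det-7: configuration-valid endgames are `≥ 0` on PSD Gram arrays -/

/-- **A PSD Hermitian Gram array is the Gram array of a finite configuration with non-negative weights**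
(spectral theorem: points = eigen-indices, weights = eigenvalues `≥ 0`, test values = eigenvector
coordinates): `configGram univ (eigenvalues) (eigenvector coordinates) = G`.
[cite: Zhang2022LandauSiegel, §2 (2.16)–(2.17)] -/
theorem configGram_of_posSemidef {r : ℕ} (G : GramData r)
    (hG : Matrix.PosSemidef (Matrix.of fun a b => G a b)) :
    configGram Finset.univ hG.1.eigenvalues
      (fun a i => (hG.1.eigenvectorUnitary : Matrix (Fin r) (Fin r) ℂ) a i) = G := by
  classical
  have hspec := hG.1.spectral_theorem
  funext a b
  rw [Unitary.conjStarAlgAut_apply] at hspec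
  have hab := congrFun (congrFun hspec a) b
  rw [Matrix.of_apply, Matrix.mul_apply] at hab
  simp only [Matrix.mul_diagonal, Function.comp_apply, Matrix.star_apply] at hab
  simp only [configGram, discreteForm]
  rw [hab]
  refine Finset.sum_congr rfl fun j _ => ?_
  have hc : (RCLike.ofReal (hG.1.eigenvalues j) : ℂ) = ((hG.1.eigenvalues j : ℝ) : ℂ) := rfl
  rw [hc]
  simp only [RCLike.star_def]
  ring

/-- **E-det-7: every configuration-valid endgame objective is `≥ 0` on every PSD Gram array** — CS/Gram-type
endgames (`posEndgame`, `csEndgame`, any `ConfigValid Φ`) REDUCE to positive-semidefiniteness of the array;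
pure linear algebra. [cite: Zhang2022LandauSiegel, §2 (2.18)–(2.19), (2.34)] -/
theorem ConfigValid.nonneg_of_posSemidef {r : ℕ} {Φ : GramData r → ℝ} (hΦ : ConfigValid Φ)
    (G : GramData r) (hG : Matrix.PosSemidef (Matrix.of fun a b => G a b)) : 0 ≤ Φ G := by
  have h := hΦ Finset.univ hG.1.eigenvalues (fun i _ => hG.eigenvalues_nonneg i)
    (fun a i => (hG.1.eigenvectorUnitary : Matrix (Fin r) (Fin r) ℂ) a i)
  rwa [configGram_of_posSemidef G hG] at h

/-- In particular the POS and CS endgame objectives are `≥ 0` on every PSD Gram array.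
[cite: Zhang2022LandauSiegel, §2 (2.16), (2.18)–(2.19), (2.32)–(2.34)] -/
theorem posEndgame_csEndgame_nonneg_of_posSemidef {r : ℕ} (a b : Fin r) (G : GramData r)
    (hG : Matrix.PosSemidef (Matrix.of fun a b => G a b)) :
    0 ≤ posEndgame a G ∧ 0 ≤ csEndgame a b G :=
  ⟨ConfigValid.nonneg_of_posSemidef (configValid_pos a) G hG,
    ConfigValid.nonneg_of_posSemidef (configValid_cauchySchwarz a b) G hG⟩

end Literature.NumberTheory.LFunctions.Zhang2022.Det
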